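import Literature.Analysis.FunctionSpaces.TorusFourierModes
import Literature.Analysis.FunctionSpaces.TorusInverseLaplacian
import HarnessLib

/-!
# Weighted coefficient coordinates for Galerkin spaces of real trigonometric fields

Analysis/FunctionSpaces support file (everything proved; no definitions, no named facts).
Finite-dimensional fixed-point / Newton arguments for Fourier–Galerkin systems on `T^d`
(Temam 1979, Ch. II §1; Brezzi–Rappaz–Raviart 1980) are most conveniently run on a Euclidean
coefficient space whose norm IS the energy-type norm of the realised field.  For the enstrophy
norm `‖∇u‖₂ = √(Torus.gradNormSq u)` this is achieved by WEIGHTED coefficients: a coefficient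
vector `c : ↥S → ℂ^d` on a finite symmetric frequency set `S ∌ 0` is realised as the real
trigonometric polynomial `u_c = realTrigPoly S (k ↦ σ k • coeffExt S c k)` with a real, even
weight `σ` normalised by `4π² |k|² σ(k)² = 1` on `S` (i.e. `σ k = 1/(2π|k|)`), and then
`gradNormSq u_c = ∑_k ‖c k‖²` (Parseval).  This file is the dictionary:

* `Torus.isConjSymm_smul_coeffExt`, `Torus.isTransversal_smul_coeffExt` — reality and
  transversality pass from `c` to the weighted family (and are real-linear conditions:
  `IsSolenoidalCoeff.add/.smul`, cf. `IsRealCoeff.add/.smul` in `TorusTrigPoly`); the weighted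
  family and `realTrigPoly` are real-linear in `c` (`smul_coeffExt_add/_smul`, `realTrigPoly_smul`);
* `Torus.gradNormSq_realTrigPoly_smul_coeffExt` — the norm identity above;
* `Torus.mFourierCoeff_realTrigPoly_smul_coeffExt_eq_zero` — `u_c` is band-limited to `S` (and
  mean-zero when `0 ∉ S`: `FluidPDE/SteadyGalerkinApprox.hasZeroMean_realTrigPoly_of_zero_not_mem`);
* `Torus.hasZeroMean_of_mFourierCoeff_zero` — a continuous field with `û(0) = 0` has zero mean;
* `Torus.enstrophyWeight_neg/_ne_zero/_normalised` — the canonical weight `σ k = 1/(2π|k|)`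
  qualifies;
* `Torus.realTrigPoly_smul_coeffExt_unweight_eq` (+ `isRealCoeff_unweight`,
  `isSolenoidalCoeff_unweight`) — **surjectivity**: a continuous field band-limited to the
  punctured ball `S = {0 < |k|² ≤ N²}` is `u_c` for `c k = (σ k)⁻¹ • û k`, which is real, and
  transversal when `u` is smooth and divergence free.

All statements are parametrised by an arbitrary weight `σ : ℤ^d → ℝ` with the stated properties.

## Mathlib / tree search

Tree: `TorusTrigPoly` (`realTrigPoly`, `coeffExt`, `IsRealCoeff`, `IsSolenoidalCoeff`,
`eGradNormSq_realTrigPoly`, `mFourierCoeff_realTrigPoly`, `EuclideanSpace.conjVec_real_smul`),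
`TorusFourierModes` (`fourierTruncate_eq_self`), `TorusInverseLaplacian` (`one_le_freqNormSq_of_ne_zero`),
`FluidPDE/SteadyGalerkinApprox` (`neg_mem_freqBall_erase_zero`), `FluidPDE/NSGalerkinFourier` (`galerkinSubspace`, unweighted, sup
norm).  No weighted/enstrophy-normed coefficient dictionary (searched `coeffExt`, `weight`,
`gradNormSq_realTrigPoly`).

## References

* R. Temam, *Navier–Stokes Equations*, North-Holland (1979), Ch. II §1 (Galerkin basis of `V`). [Temam1979]
* J. C. Robinson, J. L. Rodrigo, W. Sadowski, *The Three-Dimensional Navier–Stokes Equations*,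
  CUP (2016), §4.1. [RobinsonRodrigoSadowski2016]
-/

noncomputable section

open _root_.MeasureTheory Set Filter Function UnitAddTorus
open scoped ENNReal NNReal InnerProductSpace

namespace Literature.Analysis.FunctionSpaces

namespace Torus

variable {d : Type*} [Fintype d] [DecidableEq d]
variable {S : Finset (d → ℤ)} {σ : (d → ℤ) → ℝ}

/-! ### Reality, transversality and linearity of the weighted family -/

omit [DecidableEq d] in
/-- The weighted extension of a real coefficient vector is conjugate symmetric (even real weight,
symmetric `S`). [folklore] -/
theorem isConjSymm_smul_coeffExt (hS : ∀ k ∈ S, -k ∈ S) (hσ : ∀ k, σ (-k) = σ k)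
    {c : ↥S → EuclideanSpace ℂ d} (hc : IsRealCoeff c) :
    IsConjSymm (fun k => σ k • coeffExt S c k) := by
  intro k
  dsimp only
  rw [hσ k, hc.isConjSymm_coeffExt hS k, EuclideanSpace.conjVec_real_smul]

omit [DecidableEq d] in
/-- The weighted extension of a transversal coefficient vector is transversal. [folklore] -/
theorem isTransversal_smul_coeffExt {c : ↥S → EuclideanSpace ℂ d} (hc : IsSolenoidalCoeff c) :
    IsTransversal S (fun k => σ k • coeffExt S c k) := by
  classical
  intro k hk
  dsimp only
  have h := hc ⟨k, hk⟩
  rw [coeffExt_of_mem c hk]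
  simp only [PiLp.smul_apply, Complex.real_smul]
  calc ∑ j, (k j : ℂ) * ((σ k : ℂ) * c ⟨k, hk⟩ j) = (σ k : ℂ) * ∑ j, (k j : ℂ) * c ⟨k, hk⟩ j := by
        rw [Finset.mul_sum]; exact Finset.sum_congr rfl fun j _ => by ring
    _ = 0 := by rw [h, mul_zero]

omit [DecidableEq d] in
/-- The weighted extension is additive in the coefficient vector. [folklore] -/
theorem smul_coeffExt_add (c c' : ↥S → EuclideanSpace ℂ d) :
    (fun k => σ k • coeffExt S (c + c') k) =
      (fun k => σ k • coeffExt S c k) + fun k => σ k • coeffExt S c' k := by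
  classical
  funext k
  simp only [coeffExt_add, Pi.add_apply, smul_add]

omit [DecidableEq d] in
/-- The weighted extension commutes with real scalars. [folklore] -/
theorem smul_coeffExt_smul (a : ℝ) (c : ↥S → EuclideanSpace ℂ d) :
    (fun k => σ k • coeffExt S (a • c) k) = a • fun k => σ k • coeffExt S c k := by
  classical
  funext k
  simp only [coeffExt_smul, Pi.smul_apply, smul_comm (σ k) a]

omit [Fintype d] [DecidableEq d] in
/-- The zero coefficient vector is real. [folklore] -/
theorem isRealCoeff_zero : IsRealCoeff (S := S) (0 : ↥S → EuclideanSpace ℂ d) :=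
  fun k l _ => by simp

omit [DecidableEq d] in
/-- The zero coefficient vector is transversal. [folklore] -/
theorem isSolenoidalCoeff_zero : IsSolenoidalCoeff (S := S) (0 : ↥S → EuclideanSpace ℂ d) :=
  fun k => by simp

omit [DecidableEq d] in
/-- Transversal coefficient vectors form a real subspace: sums. [folklore] -/
theorem IsSolenoidalCoeff.add {c c' : ↥S → EuclideanSpace ℂ d} (hc : IsSolenoidalCoeff c)
    (hc' : IsSolenoidalCoeff c') : IsSolenoidalCoeff (c + c') := fun k => by
  simp only [Pi.add_apply, PiLp.add_apply, mul_add, Finset.sum_add_distrib, hc k, hc' k, add_zero]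

omit [DecidableEq d] in
/-- Transversal coefficient vectors form a real subspace: real multiples. [folklore] -/
theorem IsSolenoidalCoeff.smul {c : ↥S → EuclideanSpace ℂ d} (hc : IsSolenoidalCoeff c) (a : ℝ) :
    IsSolenoidalCoeff (a • c) := fun k => by
  simp only [Pi.smul_apply, PiLp.smul_apply, Complex.real_smul, mul_left_comm _ (a : ℂ),
    ← Finset.mul_sum, hc k, mul_zero]

omit [DecidableEq d] in
/-- `realTrigPoly` commutes with real scalars in the coefficients. [folklore] -/
theorem realTrigPoly_smul (S : Finset (d → ℤ)) (a : ℝ) (c : (d → ℤ) → EuclideanSpace ℂ d) :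
    realTrigPoly S (a • c) = a • realTrigPoly S c := by
  have h : a • c = (a : ℂ) • c := by
    funext k; simp only [Pi.smul_apply, Complex.coe_smul]
  funext x
  rw [Pi.smul_apply, realTrigPoly_apply, realTrigPoly_apply, h, trigPoly_smul, Pi.smul_apply,
    Complex.coe_smul, map_smul]

/-! ### The realised field: enstrophy norm, band-limitation, mean -/

/-- **Enstrophy of the weighted realisation is the Euclidean norm of the coefficients**:
for a real coefficient vector `c` on a symmetric `S` and a real even weight with
`4π² |k|² σ(k)² = 1` on `S`, `gradNormSq (realTrigPoly S (k ↦ σ k • c k)) = ∑_k ‖c k‖²`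
(Parseval, `Torus.eGradNormSq_realTrigPoly`). [cite: Temam1979, Ch. II §1 (1.25)] -/
theorem gradNormSq_realTrigPoly_smul_coeffExt (hS : ∀ k ∈ S, -k ∈ S) (hσ : ∀ k, σ (-k) = σ k)
    (hσ1 : ∀ k ∈ S, 4 * Real.pi ^ 2 * freqNormSq k * σ k ^ 2 = 1)
    {c : ↥S → EuclideanSpace ℂ d} (hc : IsRealCoeff c) :
    gradNormSq (realTrigPoly S (fun k => σ k • coeffExt S c k)) = ∑ k : ↥S, ‖c k‖ ^ 2 := by
  have hC : IsConjSymm (fun k => σ k • coeffExt S c k) := isConjSymm_smul_coeffExt hS hσ hc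
  rw [gradNormSq_eq_toReal_eGradNormSq_holds (isSmooth_realTrigPoly S _),
    toReal_eGradNormSq_realTrigPoly hS hC, Finset.mul_sum, ← sum_coeffExt (fun _ v => ‖v‖ ^ 2) c]
  refine Finset.sum_congr rfl fun k hk => ?_
  rw [norm_smul, Real.norm_eq_abs, mul_pow, sq_abs]
  calc 4 * Real.pi ^ 2 * (freqNormSq k * (σ k ^ 2 * ‖coeffExt S c k‖ ^ 2))
      = (4 * Real.pi ^ 2 * freqNormSq k * σ k ^ 2) * ‖coeffExt S c k‖ ^ 2 := by ring
    _ = ‖coeffExt S c k‖ ^ 2 := by rw [hσ1 k hk, one_mul]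

omit [DecidableEq d] in
/-- The weighted realisation of a real coefficient vector has no Fourier modes off `S`. [folklore] -/
theorem mFourierCoeff_realTrigPoly_smul_coeffExt_eq_zero (hS : ∀ k ∈ S, -k ∈ S)
    (hσ : ∀ k, σ (-k) = σ k) {c : ↥S → EuclideanSpace ℂ d} (hc : IsRealCoeff c) {k : d → ℤ}
    (hk : k ∉ S) :
    mFourierCoeff (EuclideanSpace.complexify ∘ realTrigPoly S (fun k => σ k • coeffExt S c k)) k = 0 :=
  mFourierCoeff_realTrigPoly_eq_zero hS (isConjSymm_smul_coeffExt hS hσ hc) hk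

omit [DecidableEq d] in
/-- **A field without mean mode has zero mean**: for continuous `u : T^d → ℝ^d`,
`𝓕(complexify ∘ u)(0) = complexify (∫ u)`, so `û(0) = 0` forces `∫ u = 0`. In particular fields
band-limited to a punctured frequency ball are mean-zero. [folklore] -/
theorem hasZeroMean_of_mFourierCoeff_zero {u : UnitAddTorus d → EuclideanSpace ℝ d}
    (h0 : mFourierCoeff (EuclideanSpace.complexify ∘ u) 0 = 0) : HasZeroMean u := by
  have h : mFourierCoeff (EuclideanSpace.complexify ∘ u) 0 = EuclideanSpace.complexify (∫ x, u x) := by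
    rw [mFourierCoeff_eq_integral_volume, neg_zero, mFourier_zero]
    simp only [ContinuousMap.one_apply, one_smul, Function.comp_apply]
    exact EuclideanSpace.complexify.integral_comp_comm u
  rw [h] at h0
  exact EuclideanSpace.complexify_injective (by rw [h0, map_zero])

/-! ### Surjectivity onto band-limited fields (punctured frequency balls) -/

/-! ### The enstrophy weight `1/(2π|k|)` -/

omit [DecidableEq d] in
/-- The enstrophy weight `1/(2π|k|)` is even. [folklore] -/
theorem enstrophyWeight_neg (k : d → ℤ) :
    (2 * Real.pi * Real.sqrt (freqNormSq (-k)))⁻¹ = (2 * Real.pi * Real.sqrt (freqNormSq k))⁻¹ := by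
  rw [freqNormSq_neg]

omit [DecidableEq d] in
/-- The enstrophy weight does not vanish off the mean mode. [folklore] -/
theorem enstrophyWeight_ne_zero {k : d → ℤ} (hk : k ≠ 0) :
    (2 * Real.pi * Real.sqrt (freqNormSq k))⁻¹ ≠ 0 := by
  have h1 : 0 < freqNormSq k := lt_of_lt_of_le one_pos (one_le_freqNormSq_of_ne_zero hk)
  exact inv_ne_zero (mul_ne_zero (mul_ne_zero two_ne_zero Real.pi_ne_zero) (Real.sqrt_pos.2 h1).ne')

omit [DecidableEq d] in
/-- The normalisation `4π² |k|² (1/(2π|k|))² = 1` off the mean mode. [folklore] -/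
theorem enstrophyWeight_normalised {k : d → ℤ} (hk : k ≠ 0) :
    4 * Real.pi ^ 2 * freqNormSq k * ((2 * Real.pi * Real.sqrt (freqNormSq k))⁻¹) ^ 2 = 1 := by
  have h1 : 0 < freqNormSq k := lt_of_lt_of_le one_pos (one_le_freqNormSq_of_ne_zero hk)
  have h3 : (2 * Real.pi * Real.sqrt (freqNormSq k)) ^ 2 = 4 * Real.pi ^ 2 * freqNormSq k := by
    rw [mul_pow, mul_pow, Real.sq_sqrt h1.le]; norm_num
  rw [inv_pow, h3]
  exact mul_inv_cancel₀ (by positivity)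

/-- **Un-weighting the Fourier coefficients realises a band-limited field.**  Let
`S = {0 < |k|² ≤ N²}`, `σ ≠ 0` on `S`, and let `u : T^d → ℝ^d` be continuous with `û(k) = 0` off
`S`.  Then the weighted realisation of the coefficient vector `c k = (σ k)⁻¹ • û k` is `u` itself
(`P_N u = u` for band-limited `u`, `Torus.fourierTruncate_eq_self`, and the mean mode is absent).
[cite: RobinsonRodrigoSadowski2016, §4.1] -/
theorem realTrigPoly_smul_coeffExt_unweight_eq {N : ℕ} {u : UnitAddTorus d → EuclideanSpace ℝ d}
    (hu : Continuous u)
    (hband : ∀ k ∉ (freqBall (d := d) N).erase 0, mFourierCoeff (EuclideanSpace.complexify ∘ u) k = 0)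
    (hσ0 : ∀ k ∈ (freqBall (d := d) N).erase 0, σ k ≠ 0) :
    realTrigPoly ((freqBall (d := d) N).erase 0)
        (fun k => σ k • coeffExt ((freqBall (d := d) N).erase 0)
          (fun k => (σ k)⁻¹ • mFourierCoeff (EuclideanSpace.complexify ∘ u) k) k) = u := by
  set S' : Finset (d → ℤ) := (freqBall (d := d) N).erase 0 with hS'
  set C : (d → ℤ) → EuclideanSpace ℂ d := fun k => mFourierCoeff (EuclideanSpace.complexify ∘ u) k
    with hCdef
  -- on `S'` the weights cancel
  have h1 : realTrigPoly S' (fun k => σ k • coeffExt S' (fun k => (σ k)⁻¹ • C k) k) =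
      realTrigPoly S' C := by
    refine realTrigPoly_congr fun k hk => ?_
    rw [coeffExt_of_mem _ hk, smul_smul, mul_inv_cancel₀ (hσ0 k hk), one_smul]
  -- the mean mode is absent, so the punctured and the full ball give the same polynomial
  have h2 : realTrigPoly (freqBall (d := d) N) C = realTrigPoly S' C := by
    rw [realTrigPoly_eq_comp, realTrigPoly_eq_comp,
      trigPoly_subset (Finset.erase_subset 0 (freqBall N)) fun k hk hkS => hband k hkS]
  -- and the full ball gives back `u`
  have h3 : realTrigPoly (freqBall (d := d) N) C = u := by
    have h := fourierTruncate_eq_self hu (N := N) fun k hk =>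
      hband k fun hmem => (not_mem_freqBall.2 hk) (Finset.mem_of_mem_erase hmem)
    rwa [fourierTruncate_eq] at h
  rw [h1, ← h2, h3]

omit [DecidableEq d] in
/-- The un-weighted coefficient vector of a real integrable field is real (even real weight).
[folklore] -/
theorem isRealCoeff_unweight (hσ : ∀ k, σ (-k) = σ k) {u : UnitAddTorus d → EuclideanSpace ℝ d}
    (hu : Integrable u volume) :
    IsRealCoeff (S := S) fun k => (σ k)⁻¹ • mFourierCoeff (EuclideanSpace.complexify ∘ u) k := by
  intro k l h
  have hkl := isRealCoeff_mFourierCoeff (S := S) hu k l h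
  dsimp only at hkl ⊢
  rw [hkl, h, hσ, EuclideanSpace.conjVec_real_smul]

/-- The un-weighted coefficient vector of a smooth divergence-free field is transversal. [folklore] -/
theorem isSolenoidalCoeff_unweight {u : UnitAddTorus d → EuclideanSpace ℝ d} (hu : IsSmooth u)
    (hdiv : IsDivFree u) :
    IsSolenoidalCoeff (S := S) fun k => (σ k)⁻¹ • mFourierCoeff (EuclideanSpace.complexify ∘ u) k := by
  intro k
  dsimp only
  have h := hdiv.isTransversal_mFourierCoeff hu S k k.2
  simp only [PiLp.smul_apply, Complex.real_smul]
  calc ∑ j, ((k : d → ℤ) j : ℂ) * (((σ k)⁻¹ : ℝ) * mFourierCoeff (EuclideanSpace.complexify ∘ u) k j)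
      = ((σ k)⁻¹ : ℝ) * ∑ j, ((k : d → ℤ) j : ℂ) * mFourierCoeff (EuclideanSpace.complexify ∘ u) k j := by
        rw [Finset.mul_sum]; exact Finset.sum_congr rfl fun j _ => by ring
    _ = 0 := by rw [h, mul_zero]

end Torus

end Literature.Analysis.FunctionSpaces

end
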